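import Mathlib
import Summits.ABC.ABC.Statement
import Literature.NumberTheory.DiophantineGeometry.AbcImpliesHall
import Summits.ABC.ABC.Theorems.SoloInformedRothFace

/-!
# The Thue SIZE bound on the Roth face of `abc`, and the binomial-unit sub-face (solo-ABC-informed, s19)

`SoloInformedRothFace` gave, from `ABC`, `max(pᵈ, a qᵈ) < C(ε) · (rad(a) p q n)^{1+ε}` on every
coprime solution of the Thue equation `pᵈ − a qᵈ = ± n`. Since `rad(a) p q n ≤ rad(a) n · max(p,q)²`
and `max(p,q)ᵈ ≤ max(pᵈ, a qᵈ)`, the variables can be eliminated from the right-hand side: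

* `soloInformed_thue_size_of_abc` : `ABC → ∀ ε ∈ (0, 1/2) ∃ C ∀ d ≥ 3 …`,
  `max(p, q) < (C · (rad(a) · n)^{1+ε})^{1/(d − 2 − 2ε)}`;
  `soloInformed_cubic_thue_size_of_abc` : `d = 3`: `max(p, q) < (C · (rad(a) · n)^{1+ε})^{1/(1 − 2ε)}`.
  Compare what is proved: Baker–Stewart 1988, Thm 2 (p. 9): the solutions of `x³ − a y³ = n` satisfy
  `max(|x|,|y|) < (c₁ n)^{c₂}` with `c₂ = 10¹² · log ε_a` (`ε_a` the fundamental unit of `ℚ(a^{1/3})`)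
  and `c₁ = ε_a^{(50 log log ε_a)²}`; under `abc` the exponent of `n` is the absolute
  `(1+ε)/(1−2ε)` and `a` enters as the factor `rad(a)^{(1+ε)/(1−2ε)}` — the regulator has left the
  exponent. `soloInformed_thue_size_of_polynomialABC` : the same elimination for Oesterlé's rung `(W)`.
* THE BINOMIAL-UNIT SUB-FACE `n = 1`. By Delaunay–Nagell (Baker–Stewart 1988, Lemma 4, p. 11)
  `x³ − a y³ = 1` has at most one solution with `y ≠ 0`, and for it `x − y·a^{1/3} = ε_a^{−1}` or
  `ε_a^{−2}`; since `x − y a^{1/3} = (x² + x y a^{1/3} + y² a^{2/3})^{−1} ≍ (3x²)^{−1}`, the size of the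
  solution IS the regulator: `log(3x²) = R_a` or `2R_a` up to `o(1)`. `soloInformed_binomial_unit_of_abc` :
  `ABC` ⟹ `x < (C · (2a²)^{(1+ε)/3})^{1/(1−2ε)}` (`x ≪ a^{2/3+O(ε)}`) and
  `x³ · y^{2+2ε} < C · (2x⁴)^{1+ε}` (`y ≪ x^{1/2+O(ε)}`) for every solution of `x³ − a y³ = ± 1`;
  i.e. `abc` on this sub-face is the bound `R_a ≤ (4/3 + O(ε)) log a + O_ε(1)` for every pure cubic
  field whose fundamental unit (or its square) is binomial. Transcendence methods bound MULTIPLES of a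
  regulator, never the regulator; here the multiple is `1` or `2` by algebra, and nothing uniform in
  `a` is known for the size of the solution beyond `log x ≤ R_a ≪ a (log a)²`.
[cite: BakerStewart1988, Thm 2 p.9, Lemma 4 p.11; BombieriGubler2006, Rem 12.2.10 p.399]
-/

namespace Summit.ABC.ABC.Theorems

open Literature.NumberTheory.DiophantineGeometry UniqueFactorizationMonoid

/-- `max(p, q)ᵈ ≤ max(pᵈ, a qᵈ)` when `a ≥ 1`. [folklore] -/
theorem soloInformed_max_pow_le_max {a p q d : ℕ} (ha : 0 < a) :
    (max p q) ^ d ≤ max (p ^ d) (a * q ^ d) := by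
  rcases le_total p q with h | h
  · rw [max_eq_right h]
    calc q ^ d = 1 * q ^ d := (one_mul _).symm
      _ ≤ a * q ^ d := Nat.mul_le_mul_right _ ha
      _ ≤ max (p ^ d) (a * q ^ d) := le_max_right _ _
  · rw [max_eq_left h]
    exact le_max_left _ _

/-- `rad(a) · p · q · n ≤ rad(a) · n · max(p, q)²`. [folklore] -/
theorem soloInformed_rad_thue_le_max {a p q n : ℕ} :
    radical a * p * q * n ≤ radical a * n * (max p q) ^ 2 := by
  have hp' : p ≤ max p q := le_max_left _ _
  have hq' : q ≤ max p q := le_max_right _ _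
  calc radical a * p * q * n = radical a * n * (p * q) := by ring
    _ ≤ radical a * n * (max p q * max p q) := by gcongr
    _ = radical a * n * (max p q) ^ 2 := by ring

/-- Real-exponent elimination: `M ≥ 1`, `t < k`, `M^k < B · M^t` ⟹ `M < B^{1/(k−t)}`. [folklore] -/
theorem soloInformed_rpow_eliminate {M B k t : ℝ} (hM : 1 ≤ M) (htk : t < k)
    (h : M ^ k < B * M ^ t) : M < B ^ (1 / (k - t)) := by
  have hM0 : 0 < M := lt_of_lt_of_le one_pos hM
  have he : 0 < k - t := by linarith
  have h3 : M ^ (k - t) < B := by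
    rw [Real.rpow_sub hM0, div_lt_iff₀ (Real.rpow_pos_of_pos hM0 _)]
    exact h
  have h4 : M = (M ^ (k - t)) ^ (1 / (k - t)) := by
    rw [← Real.rpow_mul hM0.le, mul_one_div_cancel he.ne', Real.rpow_one]
  rw [h4]
  exact Real.rpow_lt_rpow (Real.rpow_nonneg hM0.le _) h3 (by positivity)

/-- `(M²)^{s} = M^{2s}` for `M ≥ 0` (real exponent). [folklore] -/
theorem soloInformed_sq_rpow {M s : ℝ} (hM : 0 ≤ M) : (M ^ 2) ^ s = M ^ (2 * s) := by
  rw [← Real.rpow_natCast M 2, ← Real.rpow_mul hM]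
  norm_num

/-- **The Thue size bound from abc.** `ABC` gives, for every `ε ∈ (0, 1/2)`, one `C > 0` such that
every coprime solution of `pᵈ − a qᵈ = ± n` (`d ≥ 3`, `gcd(p,q) = gcd(p,a) = 1`, `n ≥ 1`) has
`max(p, q) < (C · (rad(a) n)^{1+ε})^{1/(d − 2 − 2ε)}` — polynomial in `n` AND in `rad(a)`, with an
absolute exponent. Proved effective bounds carry the regulator of `ℚ(a^{1/d})` in the exponent
(Baker–Stewart 1988 Thm 2: `(c₁ n)^{10¹² log ε_a}` for `d = 3`). [cite: BakerStewart1988, Thm 2 p.9] -/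
theorem soloInformed_thue_size_of_abc (habc : _root_.ABC) :
    ∀ ε : ℝ, 0 < ε → ε < 1 / 2 → ∃ C : ℝ, 0 < C ∧ ∀ d a p q n : ℕ, 3 ≤ d → 0 < p → 0 < q → 0 < a →
      0 < n → Nat.Coprime p q → Nat.Coprime p a → (p ^ d = a * q ^ d + n ∨ a * q ^ d = p ^ d + n) →
        ((max p q : ℕ) : ℝ) <
          (C * (((radical a * n : ℕ) : ℝ)) ^ (1 + ε)) ^ (1 / ((d : ℝ) - 2 - 2 * ε)) := by
  intro ε hε hε2
  obtain ⟨C, hC, hC'⟩ := soloInformed_thue_of_abc habc ε hε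
  refine ⟨C, hC, fun d a p q n hd hp hq ha hn hpq hpa h => ?_⟩
  obtain ⟨h1, h2⟩ := hC' d a p q n hp hq ha hn hpq hpa h
  have hε1 : (0 : ℝ) ≤ 1 + ε := by linarith
  -- max(p,q)^d < C (rad a p q n)^(1+ε)
  have hmax_lt : (((max p q) ^ d : ℕ) : ℝ) < C * (((radical a * p * q * n : ℕ) : ℝ)) ^ (1 + ε) := by
    have hle : (max p q) ^ d ≤ max (p ^ d) (a * q ^ d) := soloInformed_max_pow_le_max ha
    rcases le_total (p ^ d) (a * q ^ d) with hpq' | hpq'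
    · rw [max_eq_right hpq'] at hle
      exact lt_of_le_of_lt (by exact_mod_cast hle) h2
    · rw [max_eq_left hpq'] at hle
      exact lt_of_le_of_lt (by exact_mod_cast hle) h1
  have hR : (((radical a * p * q * n : ℕ) : ℝ)) ≤
      ((radical a * n : ℕ) : ℝ) * ((max p q : ℕ) : ℝ) ^ 2 := by
    have := soloInformed_rad_thue_le_max (a := a) (p := p) (q := q) (n := n)
    exact_mod_cast this
  have hA : (0 : ℝ) < ((radical a * n : ℕ) : ℝ) := by
    have : 0 < radical a * n := Nat.mul_pos (Nat.radical_pos a) hn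
    exact_mod_cast this
  have hM : (1 : ℝ) ≤ ((max p q : ℕ) : ℝ) := by
    have : 1 ≤ max p q := le_trans hp (le_max_left _ _)
    exact_mod_cast this
  have hM0 : (0 : ℝ) ≤ ((max p q : ℕ) : ℝ) := by positivity
  have hmain : ((max p q : ℕ) : ℝ) ^ (d : ℝ) <
      (C * ((radical a * n : ℕ) : ℝ) ^ (1 + ε)) * ((max p q : ℕ) : ℝ) ^ (2 * (1 + ε)) := by
    have hmono : C * (((radical a * p * q * n : ℕ) : ℝ)) ^ (1 + ε) ≤
        C * (((radical a * n : ℕ) : ℝ) * ((max p q : ℕ) : ℝ) ^ 2) ^ (1 + ε) := by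
      gcongr
    have hcast : ((max p q : ℕ) : ℝ) ^ (d : ℝ) = (((max p q) ^ d : ℕ) : ℝ) := by
      rw [Real.rpow_natCast]; push_cast; ring
    rw [hcast]
    calc (((max p q) ^ d : ℕ) : ℝ) < C * (((radical a * n : ℕ) : ℝ) * ((max p q : ℕ) : ℝ) ^ 2) ^ (1 + ε) :=
          lt_of_lt_of_le hmax_lt hmono
      _ = (C * ((radical a * n : ℕ) : ℝ) ^ (1 + ε)) * ((max p q : ℕ) : ℝ) ^ (2 * (1 + ε)) := by
          rw [Real.mul_rpow hA.le (by positivity), soloInformed_sq_rpow hM0]; ring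
  have hd' : 2 * (1 + ε) < (d : ℝ) := by
    have : (3 : ℝ) ≤ d := by exact_mod_cast hd
    linarith
  have := soloInformed_rpow_eliminate hM hd' hmain
  have he : (d : ℝ) - 2 * (1 + ε) = (d : ℝ) - 2 - 2 * ε := by ring
  rw [he] at this
  exact this

/-- **Cube roots.** Under `ABC`: every coprime solution of `x³ − a y³ = ± n` has
`max(x, y) < (C(ε) · (rad(a) n)^{1+ε})^{1/(1−2ε)}`; compare Baker–Stewart 1988 Thm 2,
`max(|x|,|y|) < (c₁ n)^{c₂}`, `c₂ = 10¹² log ε_a`. [cite: BakerStewart1988, Thm 2 p.9] -/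
theorem soloInformed_cubic_thue_size_of_abc (habc : _root_.ABC) :
    ∀ ε : ℝ, 0 < ε → ε < 1 / 2 → ∃ C : ℝ, 0 < C ∧ ∀ a p q n : ℕ, 0 < p → 0 < q → 0 < a →
      0 < n → Nat.Coprime p q → Nat.Coprime p a → (p ^ 3 = a * q ^ 3 + n ∨ a * q ^ 3 = p ^ 3 + n) →
        ((max p q : ℕ) : ℝ) <
          (C * (((radical a * n : ℕ) : ℝ)) ^ (1 + ε)) ^ (1 / (1 - 2 * ε)) := by
  intro ε hε hε2
  obtain ⟨C, hC, hC'⟩ := soloInformed_thue_size_of_abc habc ε hε hε2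
  refine ⟨C, hC, fun a p q n hp hq ha hn hpq hpa h => ?_⟩
  have := hC' 3 a p q n le_rfl hp hq ha hn hpq hpa h
  have h3 : ((3 : ℕ) : ℝ) - 2 - 2 * ε = 1 - 2 * ε := by norm_num
  rw [h3] at this
  exact this

/-- **The Thue size bound from polynomial abc.** Oesterlé's `(W)` with exponent `M` and constant `K`
gives `max(p,q)ᵈ ≤ K · (rad(a) n)^M · max(p,q)^{2M}` on every coprime Thue solution, i.e.
`max(p,q) ≤ (K (rad(a) n)^M)^{1/(d−2M)}` for `d > 2M`: a uniform effective Thue bound in every large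
degree, which no proved method supplies (Feldman / Bugeaud–Győry: exponent `∝ R log R`). [folklore] -/
theorem soloInformed_thue_size_of_polynomialABC
    (hW : ∃ M : ℕ, ∃ K : ℝ, 0 < K ∧
      ∀ a b c : ℕ, IsABCTriple a b c → (c : ℝ) ≤ K * ((rad a b c : ℕ) : ℝ) ^ M) :
    ∃ M : ℕ, ∃ K : ℝ, 0 < K ∧ ∀ d a p q n : ℕ, 0 < p → 0 < q → 0 < a → 0 < n →
      Nat.Coprime p q → Nat.Coprime p a → (p ^ d = a * q ^ d + n ∨ a * q ^ d = p ^ d + n) →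
        ((max p q : ℕ) : ℝ) ^ d ≤
          K * (((radical a * n : ℕ) : ℝ)) ^ M * ((max p q : ℕ) : ℝ) ^ (2 * M) := by
  obtain ⟨M, K, hK, hK'⟩ := soloInformed_thue_of_polynomialABC hW
  refine ⟨M, K, hK, fun d a p q n hp hq ha hn hpq hpa h => ?_⟩
  obtain ⟨h1, h2⟩ := hK' d a p q n hp hq ha hn hpq hpa h
  have hmax_le : (((max p q) ^ d : ℕ) : ℝ) ≤ K * (((radical a * p * q * n : ℕ) : ℝ)) ^ M := by
    have hle : (max p q) ^ d ≤ max (p ^ d) (a * q ^ d) := soloInformed_max_pow_le_max ha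
    rcases le_total (p ^ d) (a * q ^ d) with hpq' | hpq'
    · rw [max_eq_right hpq'] at hle
      exact le_trans (by exact_mod_cast hle) h2
    · rw [max_eq_left hpq'] at hle
      exact le_trans (by exact_mod_cast hle) h1
  have hR : (((radical a * p * q * n : ℕ) : ℝ)) ≤
      ((radical a * n : ℕ) : ℝ) * ((max p q : ℕ) : ℝ) ^ 2 := by
    have := soloInformed_rad_thue_le_max (a := a) (p := p) (q := q) (n := n)
    exact_mod_cast this
  have hcast : ((max p q : ℕ) : ℝ) ^ d = (((max p q) ^ d : ℕ) : ℝ) := by push_cast; ring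
  rw [hcast]
  calc (((max p q) ^ d : ℕ) : ℝ) ≤ K * (((radical a * p * q * n : ℕ) : ℝ)) ^ M := hmax_le
    _ ≤ K * (((radical a * n : ℕ) : ℝ) * ((max p q : ℕ) : ℝ) ^ 2) ^ M := by gcongr
    _ = K * (((radical a * n : ℕ) : ℝ)) ^ M * ((max p q : ℕ) : ℝ) ^ (2 * M) := by
        rw [mul_pow, ← pow_mul]; ring

/-- On `x³ − a y³ = ± 1` the coprimality conditions of the Thue face are automatic. [folklore] -/
theorem soloInformed_binomial_coprime {a x y : ℕ} (h : x ^ 3 = a * y ^ 3 + 1 ∨ a * y ^ 3 = x ^ 3 + 1) :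
    Nat.Coprime x y ∧ Nat.Coprime x a := by
  have hc3 : Nat.Coprime (x ^ 3) (a * y ^ 3) := by
    rcases h with h | h
    · rw [h]; exact Nat.coprime_self_add_left.mpr (Nat.coprime_one_left _)
    · rw [h]; exact Nat.coprime_self_add_right.mpr (Nat.coprime_one_right _)
  have hx : Nat.Coprime x (a * y ^ 3) :=
    Nat.Coprime.coprime_dvd_left (dvd_pow_self x (by norm_num)) hc3
  exact ⟨Nat.Coprime.coprime_dvd_right (dvd_mul_of_dvd_right (dvd_pow_self y (by norm_num)) a) hx,
    Nat.Coprime.coprime_dvd_right (dvd_mul_right a (y ^ 3)) hx⟩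

/-- **The binomial-unit sub-face.** Under `ABC`, for every `ε ∈ (0, 1/2)` there is `C > 0` with:
every solution of `x³ − a y³ = ± 1` in positive integers satisfies
`x < (C · (2a²)^{(1+ε)/3})^{1/(1−2ε)}` (so `x ≪ a^{2/3 + O(ε)}`) and `x³ · y^{2+2ε} < C · (2x⁴)^{1+ε}`
(so `y ≪ x^{1/2 + O(ε)}`). By Delaunay–Nagell (Baker–Stewart 1988, Lemma 4) `x − y a^{1/3}` is
`ε_a^{−1}` or `ε_a^{−2}`, so this is the bound `R_a = log ε_a ≤ (4/3 + O(ε)) log a + O_ε(1)` for every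
`a` for which the equation is solvable: `abc` bounds a REGULATOR, where linear forms in logarithms
bound only multiples of it. [cite: BakerStewart1988, Lemma 4 p.11] -/
theorem soloInformed_binomial_unit_of_abc (habc : _root_.ABC) :
    ∀ ε : ℝ, 0 < ε → ε < 1 / 2 → ∃ C : ℝ, 0 < C ∧ ∀ a x y : ℕ, 0 < a → 0 < x → 0 < y →
      (x ^ 3 = a * y ^ 3 + 1 ∨ a * y ^ 3 = x ^ 3 + 1) →
        ((x : ℕ) : ℝ) < (C * (((2 * a ^ 2 : ℕ) : ℝ)) ^ ((1 + ε) / 3)) ^ (1 / (1 - 2 * ε)) ∧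
        ((x : ℕ) : ℝ) ^ 3 * (((y : ℕ) : ℝ) ^ 2) ^ (1 + ε) < C * (((2 * x ^ 4 : ℕ) : ℝ)) ^ (1 + ε) := by
  intro ε hε hε2
  obtain ⟨C, hC, hC'⟩ := soloInformed_thue_of_abc habc ε hε
  refine ⟨C, hC, fun a x y ha hx hy h => ?_⟩
  obtain ⟨hxy, hxa⟩ := soloInformed_binomial_coprime h
  obtain ⟨h1, h2⟩ := hC' 3 a x y 1 hx hy ha one_pos hxy hxa h
  have hε1 : (0 : ℝ) ≤ 1 + ε := by linarith
  -- notation-free facts in ℕ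
  have hx3pos : 1 ≤ x ^ 3 := Nat.one_le_pow _ _ hx
  have hay : a * y ^ 3 ≤ 2 * x ^ 3 := by rcases h with h | h <;> omega
  have hx3lt : ((x ^ 3 : ℕ) : ℝ) < C * (((radical a * x * y * 1 : ℕ) : ℝ)) ^ (1 + ε) := by
    rcases h with h | h
    · exact h1
    · have : ((x ^ 3 : ℕ) : ℝ) ≤ ((a * y ^ 3 : ℕ) : ℝ) := by exact_mod_cast (by omega : x ^ 3 ≤ a * y ^ 3)
      exact lt_of_le_of_lt this h2
  have hRle : radical a * x * y * 1 ≤ a * x * y := by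
    have : radical a ≤ a := Nat.radical_le_self_iff.mpr ha.ne'
    calc radical a * x * y * 1 = radical a * x * y := by ring
      _ ≤ a * x * y := by gcongr
  have hR0 : (0 : ℝ) ≤ ((radical a * x * y * 1 : ℕ) : ℝ) := by positivity
  -- (i) the bound in terms of a:  R^3 ≤ 2 a^2 x^6
  have hR3 : (radical a * x * y * 1) ^ 3 ≤ 2 * a ^ 2 * x ^ 6 := by
    calc (radical a * x * y * 1) ^ 3 ≤ (a * x * y) ^ 3 := Nat.pow_le_pow_left hRle 3
      _ = a ^ 2 * x ^ 3 * (a * y ^ 3) := by ring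
      _ ≤ a ^ 2 * x ^ 3 * (2 * x ^ 3) := by gcongr
      _ = 2 * a ^ 2 * x ^ 6 := by ring
  have hX1 : (1 : ℝ) ≤ ((x : ℕ) : ℝ) := by exact_mod_cast hx
  have hX0 : (0 : ℝ) ≤ ((x : ℕ) : ℝ) := by positivity
  have hA0 : (0 : ℝ) ≤ ((2 * a ^ 2 : ℕ) : ℝ) := by positivity
  have hpart1 : ((x : ℕ) : ℝ) ^ (3 : ℝ) <
      (C * (((2 * a ^ 2 : ℕ) : ℝ)) ^ ((1 + ε) / 3)) * ((x : ℕ) : ℝ) ^ (2 * (1 + ε)) := by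
    have hR3' : (((radical a * x * y * 1 : ℕ) : ℝ)) ^ 3 ≤ ((2 * a ^ 2 : ℕ) : ℝ) * ((x : ℕ) : ℝ) ^ 6 := by
      exact_mod_cast hR3
    -- R^(1+ε) = (R^3)^((1+ε)/3) ≤ (2a^2 x^6)^((1+ε)/3) = (2a^2)^((1+ε)/3) x^(2(1+ε))
    have hconv : (((radical a * x * y * 1 : ℕ) : ℝ)) ^ (1 + ε) =
        ((((radical a * x * y * 1 : ℕ) : ℝ)) ^ 3) ^ ((1 + ε) / 3) := by
      rw [← Real.rpow_natCast _ 3, ← Real.rpow_mul hR0]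
      congr 1; push_cast; ring
    have hmono : ((((radical a * x * y * 1 : ℕ) : ℝ)) ^ 3) ^ ((1 + ε) / 3) ≤
        (((2 * a ^ 2 : ℕ) : ℝ) * ((x : ℕ) : ℝ) ^ 6) ^ ((1 + ε) / 3) :=
      Real.rpow_le_rpow (by positivity) hR3' (by positivity)
    have hsplit : (((2 * a ^ 2 : ℕ) : ℝ) * ((x : ℕ) : ℝ) ^ 6) ^ ((1 + ε) / 3) =
        ((2 * a ^ 2 : ℕ) : ℝ) ^ ((1 + ε) / 3) * ((x : ℕ) : ℝ) ^ (2 * (1 + ε)) := by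
      rw [Real.mul_rpow hA0 (by positivity)]
      congr 1
      rw [← Real.rpow_natCast _ 6, ← Real.rpow_mul hX0]
      congr 1; push_cast; ring
    have hcast : ((x : ℕ) : ℝ) ^ (3 : ℝ) = ((x ^ 3 : ℕ) : ℝ) := by
      rw [show (3 : ℝ) = ((3 : ℕ) : ℝ) by norm_num, Real.rpow_natCast]; push_cast; ring
    rw [hcast]
    calc ((x ^ 3 : ℕ) : ℝ) < C * (((radical a * x * y * 1 : ℕ) : ℝ)) ^ (1 + ε) := hx3lt
      _ = C * ((((radical a * x * y * 1 : ℕ) : ℝ)) ^ 3) ^ ((1 + ε) / 3) := by rw [hconv]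
      _ ≤ C * ((((2 * a ^ 2 : ℕ) : ℝ) * ((x : ℕ) : ℝ) ^ 6) ^ ((1 + ε) / 3)) := by gcongr
      _ = (C * (((2 * a ^ 2 : ℕ) : ℝ)) ^ ((1 + ε) / 3)) * ((x : ℕ) : ℝ) ^ (2 * (1 + ε)) := by
          rw [hsplit]; ring
  have ht : 2 * (1 + ε) < (3 : ℝ) := by linarith
  have hres1 := soloInformed_rpow_eliminate hX1 ht hpart1
  have he : (3 : ℝ) - 2 * (1 + ε) = 1 - 2 * ε := by ring
  rw [he] at hres1
  -- (ii) the bound y ≪ x^{1/2}:  x^3 (y^2)^(1+ε) < C (R y^2)^(1+ε) ≤ C (2 x^4)^(1+ε)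
  have hY0 : (0 : ℝ) ≤ ((y : ℕ) : ℝ) ^ 2 := by positivity
  have hRy : (((radical a * x * y * 1 : ℕ) : ℝ)) * ((y : ℕ) : ℝ) ^ 2 ≤ ((2 * x ^ 4 : ℕ) : ℝ) := by
    have : radical a * x * y * 1 * y ^ 2 ≤ 2 * x ^ 4 := by
      calc radical a * x * y * 1 * y ^ 2 ≤ a * x * y * y ^ 2 := by gcongr
        _ = x * (a * y ^ 3) := by ring
        _ ≤ x * (2 * x ^ 3) := by gcongr
        _ = 2 * x ^ 4 := by ring
    exact_mod_cast this
  have hpart2 : ((x : ℕ) : ℝ) ^ 3 * (((y : ℕ) : ℝ) ^ 2) ^ (1 + ε) <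
      C * (((2 * x ^ 4 : ℕ) : ℝ)) ^ (1 + ε) := by
    have hYpos : (0 : ℝ) < (((y : ℕ) : ℝ) ^ 2) ^ (1 + ε) := by
      apply Real.rpow_pos_of_pos; positivity
    have hcast : ((x : ℕ) : ℝ) ^ 3 = ((x ^ 3 : ℕ) : ℝ) := by push_cast; ring
    calc ((x : ℕ) : ℝ) ^ 3 * (((y : ℕ) : ℝ) ^ 2) ^ (1 + ε)
          < C * (((radical a * x * y * 1 : ℕ) : ℝ)) ^ (1 + ε) * (((y : ℕ) : ℝ) ^ 2) ^ (1 + ε) := by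
            rw [hcast]; exact mul_lt_mul_of_pos_right hx3lt hYpos
      _ = C * ((((radical a * x * y * 1 : ℕ) : ℝ)) * ((y : ℕ) : ℝ) ^ 2) ^ (1 + ε) := by
            rw [Real.mul_rpow hR0 hY0]; ring
      _ ≤ C * (((2 * x ^ 4 : ℕ) : ℝ)) ^ (1 + ε) := by gcongr
  exact ⟨hres1, hpart2⟩

end Summit.ABC.ABC.Theorems
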